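import Literature.MathematicalPhysics.QuantumFieldTheory.OSPositivityTube
import Literature.MathematicalPhysics.QuantumLattice.SchwartzPartition
import Literature.MathematicalPhysics.QuantumLattice.SchwartzTranslationCutoff
import Mathlib.MeasureTheory.Function.SimpleFuncDense
import HarnessLib

/-!
# Wightman positivity from reflection positivity, III: boundary values (`OS1973_positiveDefinite`)

Discharge of the named fact `Literature.MathematicalPhysics.QuantumFieldTheory.OS1973_positiveDefinite`
(`WightmanProofs`; Osterwalder–Schrader I (1973), §4.3 "Positivity": property (e) of
Streater–Wightman for the boundary values of an OS continuation family):
`OS1973_positiveDefinite_holds`. Steps 3–4 of the Glaser route (Steps 1–2 are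
`isPosSemidefKernelOn_osKernel_euclidPts`, `isPosSemidefKernelOn_osKernel_mixedPts`):

* **Step 3** (`sum_boundaryValue_nonneg_of_hasCompactSupport`): for compactly supported test
  functions `Fᵢ`, `∑ᵢⱼ 𝒲(Fᵢ* ⊗ Fⱼ) ≥ 0`. Along the ray direction
  `η^{pq} = ((1, …, p), (p+2, …, p+q+1)) ê₀ ∈` base cone, the approximating integral of
  `𝒲_{p+q}(Fᵢ* ⊗ Fⱼ)` is `∫∫ 𝕂(Φₜ x, Φₜ x') conj Fᵢ(x) Fⱼ(x') dx dx'` with the ray points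
  `Φₜ x = x + i t (1, 2, …) ê₀` (`osKernel_rayConfig`: conjugate reversal, an imaginary time
  shift absorbed by `𝔚ext`, `revConj_ray`), the ray points are mixed points, so the kernel is
  positive-semidefinite there, and a positive-semidefinite continuous kernel integrates
  nonnegatively against `conj f ⊗ f` (`sum_integral_integral_kernel_nonneg`: discretisation by
  simple functions `SimpleFunc.approxOn`, dominated convergence); let `t → 0⁺`.
* **Step 4** (`OS1973_positiveDefinite_holds`): general Schwartz `Fᵢ` by the product cutoffs
  `∏ₖ χ(x_k/R)` (rev-invariant and append-multiplicative, so that the cut-off witnesses are again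
  append tensors of adjoints), which converge in `𝓢` (`tendsto_smulLeftCLM_of_eq_one` of
  `SchwartzPartition`), and continuity of `𝒲ₙ`.

## References

* K. Osterwalder, R. Schrader, Comm. Math. Phys. 31 (1973) 83–112, §4.3. [OsterwalderSchraderCMP1973]
* V. Glaser, Comm. Math. Phys. 37 (1974) 257–272, §2. [GlaserCMP1974]
* R. F. Streater, A. S. Wightman, *PCT, Spin and Statistics, and All That*, §3-4 (3-29).
-/

noncomputable section

open MeasureTheory Filter Complex ComplexConjugate Metric Set
open scoped Topology ComplexOrder SchwartzMap BigOperators ContDiff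
open Literature.MathematicalPhysics.QuantumLattice Literature.Analysis.Complex

namespace Literature.MathematicalPhysics.QuantumFieldTheory

variable {d : ℕ}

/-! ### Rays along the standard direction are mixed points -/

section Rays

variable {n p q : ℕ}

variable (d n) in
/-- The standard base-cone direction `η_k = (k+1) ê₀` (`stdDirection_mem_tubeCone`). [folklore] -/
def stdDir : Fin n → SpaceTime d := fun k => (((k : ℕ) : ℝ) + 1) • e₀ d

/-- `stdDir ∈` base cone. [folklore] -/
theorem stdDir_mem_tubeCone : stdDir d n ∈ tubeCone d n := stdDirection_mem_tubeCone

/-- The Euclidean data of the ray point `x + i t η`, `η = stdDir`: Euclidean times `t (k+1)`,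
spatial coordinates those of `x`. [folklore] -/
def rayEuclid (t : ℝ) (x : Fin n → SpaceTime d) : Fin n → EuclideanSpace ℝ (Fin (d + 1)) :=
  fun k => x k + EuclideanSpace.single 0 (t * (((k : ℕ) : ℝ) + 1) - x k 0)

/-- Coordinates of `rayEuclid`. [folklore] -/
theorem rayEuclid_apply_zero (t : ℝ) (x : Fin n → SpaceTime d) (k : Fin n) :
    rayEuclid t x k 0 = t * (((k : ℕ) : ℝ) + 1) := by
  simp [rayEuclid]

/-- Coordinates of `rayEuclid`. [folklore] -/
theorem rayEuclid_apply_of_ne (t : ℝ) (x : Fin n → SpaceTime d) (k : Fin n) {μ : Fin (d + 1)}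
    (hμ : μ ≠ 0) : rayEuclid t x k μ = x k μ := by
  simp [rayEuclid, hμ]

/-- **Ray points along `stdDir` are mixed points**: `x + i t η = M(rayEuclid t x, x⁰)`. [folklore] -/
theorem rayConfig_stdDir_eq_mixedPoint (x : Fin n → SpaceTime d) (t : ℝ) :
    rayConfig (stdDir d n) x t = mixedPoint (rayEuclid t x) (fun k => x k 0) := by
  funext k μ
  by_cases hμ : μ = 0
  · subst hμ
    simp only [rayConfig, Pi.add_apply, Pi.smul_apply, complexifyPoint_apply, smul_eq_mul,
      mixedPoint, if_true, rayEuclid_apply_zero, stdDir, PiLp.smul_apply, e₀_apply]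
    push_cast
    ring
  · simp only [rayConfig, Pi.add_apply, Pi.smul_apply, complexifyPoint_apply, smul_eq_mul,
      mixedPoint, if_neg hμ, rayEuclid_apply_of_ne t x k hμ, stdDir, PiLp.smul_apply, e₀_apply,
      mul_zero, ofReal_zero, add_zero]

/-- For `t > 0` the Euclidean data of a ray point are time-ordered. [folklore] -/
theorem rayEuclid_mem_timeOrderedRegion {t : ℝ} (ht : 0 < t) (x : Fin n → SpaceTime d) :
    rayEuclid t x ∈ timeOrderedRegion d n := by
  refine ⟨fun k => ?_, fun i j hij => ?_⟩
  · rw [rayEuclid_apply_zero]; positivity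
  · simp only [rayEuclid_apply_zero]
    have : ((i : ℕ) : ℝ) < (j : ℕ) := by exact_mod_cast hij
    nlinarith

/-- Ray points along `stdDir`, `t > 0`, are mixed points. [folklore] -/
theorem rayConfig_stdDir_mem_mixedPts {t : ℝ} (ht : 0 < t) (x : Fin n → SpaceTime d) :
    (⟨n, rayConfig (stdDir d n) x t⟩ : Σ n, (Fin n → Fin (d + 1) → ℂ)) ∈ mixedPts d :=
  ⟨rayEuclid t x, rayEuclid_mem_timeOrderedRegion ht x, fun k => x k 0,
    rayConfig_stdDir_eq_mixedPoint x t⟩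

variable (d p q) in
/-- The **pair direction** `η^{pq} = ((1, 2, …, p), (p+2, …, p+q+1)) ê₀`: the base-cone direction
along which the boundary value of `𝔚_{p+q}` tested against `F* ⊗ G` is the kernel pairing. [folklore] -/
def pairDir : Fin (p + q) → SpaceTime d :=
  fun k => (Fin.append (fun i : Fin p => ((i : ℕ) : ℝ) + 1) (fun j : Fin q => (p : ℝ) + 2 + j) k) • e₀ d

/-- A direction `(c_k ê₀)_k` with `c` strictly increasing and positive lies in the base cone. [folklore] -/
theorem smul_e₀_mem_tubeCone_of_strictMono {N : ℕ} {c : Fin N → ℝ} (hc : StrictMono c)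
    (hc0 : ∀ k, 0 < c k) : (fun k => c k • e₀ d) ∈ tubeCone d N := by
  intro k
  rw [succDiff_map (fun s : ℝ => s • e₀ d) (fun a b => sub_smul a b _), smul_e₀_mem_forwardCone_iff]
  cases N with
  | zero => exact k.elim0
  | succ m =>
    refine Fin.cases ?_ (fun j => ?_) k
    · simpa using hc0 0
    · rw [succDiff_succ, sub_pos]; exact hc (Fin.castSucc_lt_succ (i := j))

/-- The pair profile `((1, …, p), (p+2, …, p+q+1))` is strictly increasing … [folklore] -/
theorem strictMono_pairProfile :
    StrictMono (Fin.append (fun i : Fin p => ((i : ℕ) : ℝ) + 1) (fun j : Fin q => (p : ℝ) + 2 + j)) := by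
  refine strictMono_fin_append (fun i j hij => ?_) (fun i j hij => ?_) (fun i j => ?_)
  · have : ((i : ℕ) : ℝ) < (j : ℕ) := by exact_mod_cast hij
    linarith
  · have : ((i : ℕ) : ℝ) < (j : ℕ) := by exact_mod_cast hij
    linarith
  · have : ((i : ℕ) : ℝ) + 1 ≤ p := by exact_mod_cast i.2
    linarith [(j : ℕ).cast_nonneg (α := ℝ)]

/-- … and positive. [folklore] -/
theorem pairProfile_pos (k : Fin (p + q)) :
    0 < Fin.append (fun i : Fin p => ((i : ℕ) : ℝ) + 1) (fun j : Fin q => (p : ℝ) + 2 + j) k := by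
  induction k using Fin.addCases with
  | left i => rw [Fin.append_left]; positivity
  | right j => rw [Fin.append_right]; positivity

/-- The pair direction lies in the base cone. [folklore] -/
theorem pairDir_mem_tubeCone : pairDir d p q ∈ tubeCone d (p + q) :=
  smul_e₀_mem_tubeCone_of_strictMono strictMono_pairProfile pairProfile_pos

/-- Components of the standard direction. [folklore] -/
theorem stdDir_apply (k : Fin n) (μ : Fin (d + 1)) :
    stdDir d n k μ = if μ = 0 then ((k : ℕ) : ℝ) + 1 else 0 := by
  simp [stdDir, e₀_apply]

/-- Components of the pair direction. [folklore] -/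
theorem pairDir_apply (k : Fin (p + q)) (μ : Fin (d + 1)) :
    pairDir d p q k μ = if μ = 0 then
      Fin.append (fun i : Fin p => ((i : ℕ) : ℝ) + 1) (fun j : Fin q => (p : ℝ) + 2 + j) k else 0 := by
  simp [pairDir, e₀_apply]

/-- Components of a ray configuration. [folklore] -/
theorem rayConfig_apply (η x : Fin n → SpaceTime d) (t : ℝ) (k : Fin n) (μ : Fin (d + 1)) :
    rayConfig η x t k μ = (x k μ : ℂ) + (t : ℂ) * I * (η k μ : ℂ) := by
  simp [rayConfig, smul_eq_mul]

/-- Components of the imaginary time shift. [folklore] -/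
theorem iTimeShift_apply (s : ℝ) (k : Fin n) (μ : Fin (d + 1)) :
    iTimeShift d n s k μ = if μ = 0 then I * (s : ℂ) else 0 := by
  by_cases hμ : μ = 0
  · subst hμ; simp [iTimeShift]
  · simp [iTimeShift, euclideanPoint, hμ]

/-- The value of `Fin.rev` as a real number. [folklore] -/
theorem cast_val_rev (i : Fin p) : (((Fin.rev i : Fin p) : ℕ) : ℝ) = (p : ℝ) - i - 1 := by
  rw [Fin.val_rev]
  have : (i : ℕ) + 1 ≤ p := i.2
  push_cast [Nat.cast_sub this]
  ring

/-- **The conjugate-reversed ray appended to a ray, after the imaginary time shift `t (p+1)`, is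
the ray of the appended real configuration in the pair direction.** [folklore] -/
theorem append_revConj_rayConfig_add_iTimeShift (x : Fin p → SpaceTime d) (x' : Fin q → SpaceTime d)
    (t : ℝ) :
    Fin.append (revConj (rayConfig (stdDir d p) x t)) (rayConfig (stdDir d q) x' t) +
        iTimeShift d (p + q) (t * ((p : ℝ) + 1)) =
      rayConfig (pairDir d p q) (Fin.append (fun k => x (Fin.rev k)) x') t := by
  funext k μ
  rw [Pi.add_apply, Pi.add_apply, rayConfig_apply, iTimeShift_apply, pairDir_apply]
  induction k using Fin.addCases with
  | left i =>
    rw [Fin.append_left, Fin.append_left, Fin.append_left, revConj_apply, rayConfig_apply, stdDir_apply]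
    by_cases hμ : μ = 0
    · subst hμ
      simp only [if_true, map_add, map_mul, conj_ofReal, conj_I, cast_val_rev]
      push_cast
      ring
    · simp only [if_neg hμ, conj_ofReal, ofReal_zero, mul_zero, add_zero]
  | right j =>
    rw [Fin.append_right, Fin.append_right, Fin.append_right, rayConfig_apply, stdDir_apply]
    by_cases hμ : μ = 0
    · subst hμ
      simp only [if_true]
      push_cast
      ring
    · simp only [if_neg hμ, ofReal_zero, mul_zero, add_zero]

/-- **The OS kernel at ray points is the continued Schwinger function on the appended ray**:
for `t > 0`,
`𝕂(⟨p, x + itη⟩, ⟨q, x' + itη⟩) = 𝔚_{p+q}((x_{p-1}, …, x_0, x'_0, …, x'_{q-1}) + i t η^{pq})`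
(conjugate reversal `revConj_ray`, and the imaginary time shift `t (p+1)` absorbed by the
time-shift extension `𝔚ext`). [folklore] -/
theorem osKernel_rayConfig {𝔚 : (n : ℕ) → (Fin n → Fin (d + 1) → ℂ) → ℂ}
    (hinv : ∀ s : ℝ, 0 ≤ s → ∀ z ∈ forwardTube d (p + q),
      𝔚 (p + q) (z + iTimeShift d (p + q) s) = 𝔚 (p + q) z)
    (x : Fin p → SpaceTime d) (x' : Fin q → SpaceTime d) {t : ℝ} (ht : 0 < t) :
    osKernel 𝔚 ⟨p, rayConfig (stdDir d p) x t⟩ ⟨q, rayConfig (stdDir d q) x' t⟩ =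
      𝔚 (p + q) (rayConfig (pairDir d p q) (Fin.append (fun k => x (Fin.rev k)) x') t) := by
  rw [osKernel_apply]
  set Z := Fin.append (revConj (rayConfig (stdDir d p) x t)) (rayConfig (stdDir d q) x' t) with hZ
  have hs : Z + iTimeShift d (p + q) (t * ((p : ℝ) + 1)) ∈ forwardTube d (p + q) := by
    rw [hZ, append_revConj_rayConfig_add_iTimeShift]
    exact mem_forwardTube_of_mem_tubeCone _ _ pairDir_mem_tubeCone ht
  have hrel : Z ∈ relForwardTube d (p + q) := ((add_iTimeShift_mem_forwardTube_iff Z _).1 hs).2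
  rw [tubeExtension_eq hinv hrel hs, hZ, append_revConj_rayConfig_add_iTimeShift]

end Rays

/-! ### Positive-semidefinite continuous kernels integrate nonnegatively -/

section Discretise

/-- Fibre decomposition of a function of a simple function:
`∑_{a ∈ range r} 1_{K ∩ r⁻¹{a}}(z) φ(a) = 1_K(z) φ(r z)`. [folklore] -/
theorem sum_indicator_fiber_mul {X : Type*} [MeasurableSpace X] (r : SimpleFunc X X) (K : Set X)
    (φ : X → ℂ) (z : X) :
    ∑ a ∈ r.range, (K ∩ r ⁻¹' {a}).indicator (fun _ => (1 : ℂ)) z * φ a =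
      K.indicator (fun z => φ (r z)) z := by
  classical
  by_cases hz : z ∈ K
  · rw [Set.indicator_of_mem hz, Finset.sum_eq_single (r z)]
    · rw [Set.indicator_of_mem (show z ∈ K ∩ r ⁻¹' {r z} from ⟨hz, rfl⟩), one_mul]
    · intro a _ ha
      rw [Set.indicator_of_notMem, zero_mul]
      rintro ⟨_, h⟩
      exact ha (Set.mem_singleton_iff.1 h).symm
    · intro h; exact absurd (r.mem_range_self z) h
  · rw [Set.indicator_of_notMem hz]
    refine Finset.sum_eq_zero fun a _ => ?_
    rw [Set.indicator_of_notMem (fun h => hz h.1), zero_mul]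

/-- Product of indicators as the indicator of the product set. [folklore] -/
theorem indicator_mul_indicator_eq_prod {X Y : Type*} (A : Set X) (B : Set Y) (zz : X × Y) :
    A.indicator (fun _ => (1 : ℂ)) zz.1 * B.indicator (fun _ => (1 : ℂ)) zz.2 =
      (A ×ˢ B).indicator (fun _ => (1 : ℂ)) zz := by
  by_cases h1 : zz.1 ∈ A <;> by_cases h2 : zz.2 ∈ B <;>
    simp [Set.indicator_of_mem, Set.indicator_of_notMem, h1, h2, Set.mem_prod]

variable {ι : Type} [Fintype ι]

/-- **A continuous positive-semidefinite kernel integrates nonnegatively against `conj f ⊗ f`**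
(finite family of blocks): if `κ` is positive-semidefinite on the disjoint union of the block
spaces `(ℝ^{1+d})^{mᵢ}`, continuous on each pair of blocks, and the `fᵢ` are continuous with
compact support, then `∑ᵢⱼ ∫∫ κ(⟨i, x⟩, ⟨j, x'⟩) conj fᵢ(x) fⱼ(x') dx dx' ≥ 0`. Proof:
discretise each block by simple functions `rₙ → id` on a ball carrying the supports
(`SimpleFunc.approxOn`); the discretised double integrals are finite positive-semidefinite sums
`∑ conj(fᵢ(a) wₐ) (fⱼ(b) w_b) κ(a, b)` with the fibre volumes `w ≥ 0`, and converge by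
dominated convergence. [folklore] -/
theorem sum_integral_integral_kernel_nonneg (m : ι → ℕ)
    (κ : (Σ i, (Fin (m i) → SpaceTime d)) → (Σ i, (Fin (m i) → SpaceTime d)) → ℂ)
    (hκ : IsPosSemidefKernelOn κ Set.univ)
    (hκc : ∀ i j, Continuous fun zz : (Fin (m i) → SpaceTime d) × (Fin (m j) → SpaceTime d) =>
      κ ⟨i, zz.1⟩ ⟨j, zz.2⟩)
    (f : (i : ι) → (Fin (m i) → SpaceTime d) → ℂ) (hfc : ∀ i, Continuous (f i))
    (hfK : ∀ i, HasCompactSupport (f i)) :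
    0 ≤ ∑ i, ∑ j, ∫ x, ∫ x', κ ⟨i, x⟩ ⟨j, x'⟩ * (conj (f i x) * f j x') := by
  classical
  -- compact balls carrying the supports, with the base point `0`
  have hR : ∀ i, ∃ R : ℝ, 0 ≤ R ∧ tsupport (f i) ⊆ closedBall 0 R := fun i => by
    obtain ⟨R, hR⟩ := (hfK i).isCompact.isBounded.subset_closedBall 0
    exact ⟨max R 0, le_max_right _ _, hR.trans (closedBall_subset_closedBall (le_max_left _ _))⟩
  choose R hR0 hRK using hR
  set K : (i : ι) → Set (Fin (m i) → SpaceTime d) := fun i => closedBall 0 (R i) with hK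
  have hKc : ∀ i, IsCompact (K i) := fun i => isCompact_closedBall _ _
  have h0K : ∀ i, (0 : Fin (m i) → SpaceTime d) ∈ K i := fun i => mem_closedBall_self (hR0 i)
  -- the discretisations `r i N → id` on `K i`
  set r : (i : ι) → ℕ → SimpleFunc (Fin (m i) → SpaceTime d) (Fin (m i) → SpaceTime d) :=
    fun i N => SimpleFunc.approxOn id measurable_id (K i) 0 (h0K i) N with hr
  have hr_mem : ∀ i N x, r i N x ∈ K i := fun i N x =>
    SimpleFunc.approxOn_mem measurable_id (h0K i) N x
  have hr_lim : ∀ i, ∀ x ∈ K i, Tendsto (fun N => r i N x) atTop (𝓝 x) := fun i x hx =>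
    SimpleFunc.tendsto_approxOn measurable_id (h0K i)
      (by rw [(hKc i).isClosed.closure_eq]; exact hx)
  -- the pair integrands
  set g : (i j : ι) → (Fin (m i) → SpaceTime d) × (Fin (m j) → SpaceTime d) → ℂ :=
    fun i j zz => κ ⟨i, zz.1⟩ ⟨j, zz.2⟩ * (conj (f i zz.1) * f j zz.2) with hg
  have hgc : ∀ i j, Continuous (g i j) := fun i j =>
    (hκc i j).mul ((continuous_conj.comp ((hfc i).comp continuous_fst)).mul
      ((hfc j).comp continuous_snd))
  have hg_zero : ∀ i j zz, zz ∉ K i ×ˢ K j → g i j zz = 0 := by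
    intro i j zz hzz
    rw [Set.mem_prod, not_and_or] at hzz
    rcases hzz with h | h
    · have : f i zz.1 = 0 := image_eq_zero_of_notMem_tsupport fun h' => h (hRK i h')
      simp [hg, this]
    · have : f j zz.2 = 0 := image_eq_zero_of_notMem_tsupport fun h' => h (hRK j h')
      simp [hg, this]
  have hgK : ∀ i j, HasCompactSupport (g i j) := fun i j =>
    HasCompactSupport.intro' ((hKc i).prod (hKc j)) ((hKc i).isClosed.prod (hKc j).isClosed)
      (hg_zero i j)
  have hgi : ∀ i j, Integrable (g i j) (volume.prod volume) := fun i j =>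
    (hgc i j).integrable_of_hasCompactSupport (hgK i j)
  have hiter : ∀ i j, ∫ x, ∫ x', κ ⟨i, x⟩ ⟨j, x'⟩ * (conj (f i x) * f j x') =
      ∫ zz, g i j zz ∂(volume.prod volume) := fun i j => (integral_prod (g i j) (hgi i j)).symm
  simp_rw [hiter]
  -- fibres, weights, discretised integrands
  set E : (i : ι) → ℕ → (Fin (m i) → SpaceTime d) → Set (Fin (m i) → SpaceTime d) :=
    fun i N a => K i ∩ (r i N) ⁻¹' {a} with hE
  have hEm : ∀ i N a, MeasurableSet (E i N a) := fun i N a =>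
    (hKc i).isClosed.measurableSet.inter ((r i N).measurableSet_fiber a)
  have hEfin : ∀ i N a, volume (E i N a) < ⊤ := fun i N a =>
    (measure_mono Set.inter_subset_left).trans_lt (hKc i).measure_lt_top
  set w : (i : ι) → ℕ → (Fin (m i) → SpaceTime d) → ℝ :=
    fun i N a => (volume (E i N a)).toReal with hw
  have hw0 : ∀ i N a, 0 ≤ w i N a := fun i N a => ENNReal.toReal_nonneg
  set H : (i j : ι) → ℕ → (Fin (m i) → SpaceTime d) × (Fin (m j) → SpaceTime d) → ℂ :=
    fun i j N zz => ∑ a ∈ (r i N).range, ∑ b ∈ (r j N).range,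
      (E i N a).indicator (fun _ => (1 : ℂ)) zz.1 * (E j N b).indicator (fun _ => (1 : ℂ)) zz.2 *
        g i j (a, b) with hH
  -- `H = 1_{K×K} · g ∘ (r × r)`
  have hH_eq : ∀ i j N zz, H i j N zz =
      (K i ×ˢ K j).indicator (fun zz => g i j (r i N zz.1, r j N zz.2)) zz := by
    intro i j N zz
    simp only [hH]
    have hinner : ∀ a, ∑ b ∈ (r j N).range, (E i N a).indicator (fun _ => (1 : ℂ)) zz.1 *
        (E j N b).indicator (fun _ => (1 : ℂ)) zz.2 * g i j (a, b) =
        (E i N a).indicator (fun _ => (1 : ℂ)) zz.1 *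
          (K j).indicator (fun z' => g i j (a, r j N z')) zz.2 := by
      intro a
      rw [← sum_indicator_fiber_mul (r j N) (K j) (fun b => g i j (a, b)) zz.2, Finset.mul_sum]
      refine Finset.sum_congr rfl fun b _ => ?_
      ring
    simp_rw [hinner]
    rw [sum_indicator_fiber_mul (r i N) (K i)
      (fun a => (K j).indicator (fun z' => g i j (a, r j N z')) zz.2) zz.1]
    by_cases h1 : zz.1 ∈ K i
    · by_cases h2 : zz.2 ∈ K j
      · rw [Set.indicator_of_mem h1, Set.indicator_of_mem h2,
          Set.indicator_of_mem (Set.mk_mem_prod h1 h2 : (zz.1, zz.2) ∈ K i ×ˢ K j)]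
      · rw [Set.indicator_of_mem h1, Set.indicator_of_notMem h2,
          Set.indicator_of_notMem (fun h : zz ∈ K i ×ˢ K j => h2 h.2)]
    · rw [Set.indicator_of_notMem h1,
        Set.indicator_of_notMem (fun h : zz ∈ K i ×ˢ K j => h1 h.1)]
  -- integrals of the discretised integrands
  have hterm : ∀ i j N a b, Integrable (fun zz : (Fin (m i) → SpaceTime d) × (Fin (m j) → SpaceTime d) =>
        (E i N a).indicator (fun _ => (1 : ℂ)) zz.1 * (E j N b).indicator (fun _ => (1 : ℂ)) zz.2 *
          g i j (a, b)) (volume.prod volume) ∧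
      ∫ zz, (E i N a).indicator (fun _ => (1 : ℂ)) zz.1 * (E j N b).indicator (fun _ => (1 : ℂ)) zz.2 *
          g i j (a, b) ∂(volume.prod volume) = g i j (a, b) * (w i N a * w j N b) := by
    intro i j N a b
    have hAB : MeasurableSet (E i N a ×ˢ E j N b) := (hEm i N a).prod (hEm j N b)
    have hvol : (volume.prod volume) (E i N a ×ˢ E j N b) = volume (E i N a) * volume (E j N b) :=
      Measure.prod_prod _ _
    have hfin : (volume.prod volume) (E i N a ×ˢ E j N b) < ⊤ := by
      rw [hvol]; exact ENNReal.mul_lt_top (hEfin i N a) (hEfin j N b)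
    have hind : Integrable ((E i N a ×ˢ E j N b).indicator fun _ => (1 : ℂ)) (volume.prod volume) :=
      (integrable_indicator_iff hAB).2 (integrableOn_const hfin.ne)
    simp_rw [indicator_mul_indicator_eq_prod (E i N a) (E j N b)]
    refine ⟨hind.mul_const _, ?_⟩
    rw [integral_mul_const, integral_indicator_const _ hAB, measureReal_def, hvol, ENNReal.toReal_mul]
    simp only [hw, real_smul, ofReal_mul, mul_one]
    ring
  have hH_int : ∀ i j N, ∫ zz, H i j N zz ∂(volume.prod volume) =
      ∑ a ∈ (r i N).range, ∑ b ∈ (r j N).range, g i j (a, b) * (w i N a * w j N b) := by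
    intro i j N
    simp only [hH]
    rw [integral_finsetSum _ (fun a _ => integrable_finsetSum _ fun b _ => (hterm i j N a b).1)]
    refine Finset.sum_congr rfl fun a _ => ?_
    rw [integral_finsetSum _ (fun b _ => (hterm i j N a b).1)]
    exact Finset.sum_congr rfl fun b _ => (hterm i j N a b).2
  -- positivity of the discretised sums
  have hpos : ∀ N, 0 ≤ ∑ i, ∑ j, ∫ zz, H i j N zz ∂(volume.prod volume) := by
    intro N
    rw [show (∑ i, ∑ j, ∫ zz, H i j N zz ∂(volume.prod volume)) =
        ∑ i, ∑ j, ∑ a ∈ (r i N).range, ∑ b ∈ (r j N).range, g i j (a, b) * (w i N a * w j N b) from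
      Finset.sum_congr rfl fun i _ => Finset.sum_congr rfl fun j _ => hH_int i j N]
    set S : Finset (Σ i, (Fin (m i) → SpaceTime d)) := Finset.univ.sigma fun i => (r i N).range with hS
    set c : (Σ i, (Fin (m i) → SpaceTime d)) → ℂ := fun u => f u.1 u.2 * (w u.1 N u.2 : ℂ) with hc
    have hPD := hκ.sum_nonneg (ι := ↥S) (fun u => (u : Σ i, (Fin (m i) → SpaceTime d)))
      (fun _ => Set.mem_univ _) (fun u => c u)
    have hsum : ∑ u : ↥S, ∑ v : ↥S, conj (c u) * c v * κ u v =
        ∑ i, ∑ j, ∑ a ∈ (r i N).range, ∑ b ∈ (r j N).range, g i j (a, b) * (w i N a * w j N b) := by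
      have h2 : ∀ u : Σ i, (Fin (m i) → SpaceTime d),
          ∑ v : ↥S, conj (c u) * c v * κ u v = ∑ v ∈ S, conj (c u) * c v * κ u v :=
        fun u => Finset.sum_coe_sort S (fun v => conj (c u) * c v * κ u v)
      rw [Finset.sum_coe_sort S (fun u => ∑ v : ↥S, conj (c u) * c v * κ u v)]
      simp_rw [h2]
      rw [hS, Finset.sum_sigma]
      refine Finset.sum_congr rfl fun i _ => ?_
      conv_rhs => rw [Finset.sum_comm]
      refine Finset.sum_congr rfl fun a _ => ?_
      rw [Finset.sum_sigma]
      refine Finset.sum_congr rfl fun j _ => Finset.sum_congr rfl fun b _ => ?_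
      simp only [hc, hg, map_mul, conj_ofReal]
      ring
    rwa [hsum] at hPD
  -- dominated convergence for each pair
  have hlim : ∀ i j, Tendsto (fun N => ∫ zz, H i j N zz ∂(volume.prod volume)) atTop
      (𝓝 (∫ zz, g i j zz ∂(volume.prod volume))) := by
    intro i j
    obtain ⟨M, hM⟩ := ((hKc i).prod (hKc j)).exists_bound_of_continuousOn (hgc i j).continuousOn
    have hKK : MeasurableSet (K i ×ˢ K j) := (hKc i).isClosed.measurableSet.prod (hKc j).isClosed.measurableSet
    refine tendsto_integral_of_dominated_convergence
      (fun zz => M * (K i ×ˢ K j).indicator (fun _ => (1 : ℝ)) zz) (fun N => ?_) ?_ (fun N => ?_) ?_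
    · -- measurability
      have hfun : H i j N = (K i ×ˢ K j).indicator (fun zz => g i j (r i N zz.1, r j N zz.2)) :=
        funext (hH_eq i j N)
      rw [hfun]
      refine (Measurable.aestronglyMeasurable ?_).indicator hKK
      exact (hgc i j).measurable.comp
        (((r i N).measurable.comp measurable_fst).prodMk ((r j N).measurable.comp measurable_snd))
    · -- integrable bound
      have hfin : (volume.prod volume) (K i ×ˢ K j) < ⊤ := by
        rw [Measure.prod_prod]; exact ENNReal.mul_lt_top (hKc i).measure_lt_top (hKc j).measure_lt_top
      exact ((integrable_indicator_iff hKK).2 (integrableOn_const hfin.ne)).const_mul M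
    · -- domination
      refine Eventually.of_forall fun zz => ?_
      rw [hH_eq]
      by_cases hzz : zz ∈ K i ×ˢ K j
      · rw [Set.indicator_of_mem hzz, Set.indicator_of_mem hzz, mul_one]
        exact hM _ ⟨hr_mem i N zz.1, hr_mem j N zz.2⟩
      · rw [Set.indicator_of_notMem hzz, Set.indicator_of_notMem hzz, norm_zero, mul_zero]
    · -- pointwise convergence
      refine Eventually.of_forall fun zz => ?_
      simp only [hH_eq]
      by_cases hzz : zz ∈ K i ×ˢ K j
      · simp only [Set.indicator_of_mem hzz]
        have ht : Tendsto (fun N => (r i N zz.1, r j N zz.2)) atTop (𝓝 (zz.1, zz.2)) :=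
          (hr_lim i zz.1 hzz.1).prodMk_nhds (hr_lim j zz.2 hzz.2)
        exact ((hgc i j).tendsto _).comp ht
      · simp only [Set.indicator_of_notMem hzz, hg_zero i j zz hzz]
        exact tendsto_const_nhds
  have hlim_sum : Tendsto (fun N => ∑ i, ∑ j, ∫ zz, H i j N zz ∂(volume.prod volume)) atTop
      (𝓝 (∑ i, ∑ j, ∫ zz, g i j zz ∂(volume.prod volume))) :=
    tendsto_finsetSum _ fun i _ => tendsto_finsetSum _ fun j _ => hlim i j
  exact ge_of_tendsto' hlim_sum hpos

end Discretise

/-! ### Step 3: positivity for compactly supported test functions -/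

section Step3

variable {p q : ℕ}

/-- The adjoint test function `F*(y) = conj F(y_{p-1}, …, y_0)` of a compactly supported test
function is compactly supported. [folklore] -/
theorem hasCompactSupport_starTest_permTest_revPerm {F : 𝓢((Fin p → SpaceTime d), ℂ)}
    (hF : HasCompactSupport (F : (Fin p → SpaceTime d) → ℂ)) :
    HasCompactSupport (starTest (permTest Fin.revPerm F) : (Fin p → SpaceTime d) → ℂ) := by
  have hc : Continuous fun y : Fin p → SpaceTime d => fun k => y (Fin.rev k) :=
    continuous_pi fun k => continuous_apply _
  refine HasCompactSupport.intro (hF.image hc) fun y hy => ?_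
  rw [starTest_permTest_revPerm_apply]
  have : (fun k => y (Fin.rev k)) ∉ tsupport (F : (Fin p → SpaceTime d) → ℂ) := fun h =>
    hy ⟨fun k => y (Fin.rev k), h, funext fun k => by simp [Fin.rev_rev]⟩
  rw [image_eq_zero_of_notMem_tsupport this, map_zero]

/-- A witness of `F* ⊗ G` is the `appendTensor`. [folklore] -/
theorem eq_appendTensor_of_isAppendTensorOf {E : Type*} [NormedAddCommGroup E] [NormedSpace ℝ E]
    {H : 𝓢((Fin (p + q) → E), ℂ)} {F : 𝓢((Fin p → E), ℂ)} {G : 𝓢((Fin q → E), ℂ)}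
    (hH : IsAppendTensorOf H F G) : H = SchwartzMap.appendTensor F G := by
  ext z; rw [hH z, SchwartzMap.appendTensor_apply]

/-- `𝔚` composed with a ray in a base-cone direction, `t > 0`, is continuous in the base point. [folklore] -/
theorem continuous_comp_rayConfig {n : ℕ} {𝔚 : (Fin n → Fin (d + 1) → ℂ) → ℂ}
    (h𝔚 : ContinuousOn 𝔚 (forwardTube d n)) {η : Fin n → SpaceTime d} (hη : η ∈ tubeCone d n)
    {t : ℝ} (ht : 0 < t) : Continuous fun x => 𝔚 (rayConfig η x t) :=
  h𝔚.comp_continuous ((continuous_rayConfig η).comp (continuous_id.prodMk continuous_const))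
    fun x => mem_forwardTube_of_mem_tubeCone x η hη ht

variable [NeZero d] {S : SchwingerFamily (EuclideanSpace ℝ (Fin (d + 1)))}

/-- **Step 3 of the Glaser route: Wightman positivity for compactly supported test functions.**
For an OS continuation family `𝒲` of an E1–E2 Schwinger family and compactly supported `Fᵢ` of
degrees `degᵢ` with append-tensor witnesses `Gᵢⱼ` of `Fᵢ* ⊗ Fⱼ`:
`∑ᵢⱼ 𝒲_{degᵢ+degⱼ}(Gᵢⱼ) ≥ 0`. Proof: along the pair directions `η^{pq}` the approximating
integrals of the boundary values are the kernel pairings `∑ᵢⱼ ∫∫ 𝕂(Φₜ x, Φₜ x') conj Fᵢ Fⱼ`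
(`osKernel_rayConfig`), nonnegative by Steps 1–2 and `sum_integral_integral_kernel_nonneg`;
pass to `t → 0⁺`. [cite: OsterwalderSchraderCMP1973, §4.3 (4.18) and (4.28)] -/
theorem sum_boundaryValue_nonneg_of_hasCompactSupport (hE1 : S.IsEuclideanCovariant)
    (hE2 : S.IsOSReflectionPositive)
    {𝒲 : Literature.Analysis.FunctionSpaces.WightmanFamily d Unit} (h𝒲 : IsOSContinuationFamily S 𝒲)
    {N : ℕ} (deg : Fin N → ℕ) (F : (i : Fin N) → 𝓢((Fin (deg i) → SpaceTime d), ℂ))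
    (hFc : ∀ i, HasCompactSupport (F i : (Fin (deg i) → SpaceTime d) → ℂ))
    (G : (i j : Fin N) → 𝓢((Fin (deg i + deg j) → SpaceTime d), ℂ))
    (hG : ∀ i j, IsAppendTensorOf (G i j) (starTest (permTest Fin.revPerm (F i))) (F j))
    (lab : (i j : Fin N) → Fin (deg i + deg j) → Unit) :
    0 ≤ ∑ i, ∑ j, 𝒲 (deg i + deg j) (lab i j) (G i j) := by
  choose 𝔚 h𝔚 hbv hS using h𝒲
  have hinv : ∀ n, ∀ s : ℝ, 0 ≤ s → ∀ z ∈ forwardTube d n, 𝔚 n (z + iTimeShift d n s) = 𝔚 n z :=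
    fun n => eqOn_forwardTube_add_iTimeShift hE1 (h𝔚 n) (hS n)
  have hPD := isPosSemidefKernelOn_osKernel_mixedPts hE1 hE2 𝔚 h𝔚 hS
  -- the approximating integrals
  set I : Fin N → Fin N → ℝ → ℂ := fun i j t =>
    ∫ ξ, 𝔚 (deg i + deg j) (rayConfig (pairDir d (deg i) (deg j)) ξ t) * G i j ξ with hI
  have hlim : ∀ i j, Tendsto (I i j) (𝓝[>] 0) (𝓝 (𝒲 (deg i + deg j) (lab i j) (G i j))) := by
    intro i j
    rw [unitLabels_eq (lab i j)]
    exact hbv (deg i + deg j) _ pairDir_mem_tubeCone (G i j)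
  have hlim_sum : Tendsto (fun t => ∑ i, ∑ j, I i j t) (𝓝[>] 0)
      (𝓝 (∑ i, ∑ j, 𝒲 (deg i + deg j) (lab i j) (G i j))) :=
    tendsto_finsetSum _ fun i _ => tendsto_finsetSum _ fun j _ => hlim i j
  refine ge_of_tendsto hlim_sum (eventually_nhdsWithin_of_forall fun t (ht : 0 < t) => ?_)
  -- for `t > 0`: the kernel pairing
  set κ : (Σ i : Fin N, (Fin (deg i) → SpaceTime d)) → (Σ i : Fin N, (Fin (deg i) → SpaceTime d)) → ℂ :=
    fun u v => osKernel 𝔚 ⟨deg u.1, rayConfig (stdDir d (deg u.1)) u.2 t⟩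
      ⟨deg v.1, rayConfig (stdDir d (deg v.1)) v.2 t⟩ with hκ
  have hκPD : IsPosSemidefKernelOn κ Set.univ :=
    hPD.comp (fun u : Σ i : Fin N, (Fin (deg i) → SpaceTime d) =>
      (⟨deg u.1, rayConfig (stdDir d (deg u.1)) u.2 t⟩ : Σ n, (Fin n → Fin (d + 1) → ℂ)))
      fun u _ => rayConfig_stdDir_mem_mixedPts ht u.2
  have hκ_eq : ∀ i j (x : Fin (deg i) → SpaceTime d) (x' : Fin (deg j) → SpaceTime d),
      κ ⟨i, x⟩ ⟨j, x'⟩ = 𝔚 (deg i + deg j)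
        (rayConfig (pairDir d (deg i) (deg j)) (Fin.append (fun k => x (Fin.rev k)) x') t) :=
    fun i j x x' => osKernel_rayConfig (hinv (deg i + deg j)) x x' ht
  have h𝔚c : ∀ i j, Continuous fun ξ : Fin (deg i + deg j) → SpaceTime d =>
      𝔚 (deg i + deg j) (rayConfig (pairDir d (deg i) (deg j)) ξ t) :=
    fun i j => continuous_comp_rayConfig (h𝔚 _).continuousOn pairDir_mem_tubeCone ht
  have hκc : ∀ i j, Continuous fun zz : (Fin (deg i) → SpaceTime d) × (Fin (deg j) → SpaceTime d) =>
      κ ⟨i, zz.1⟩ ⟨j, zz.2⟩ := by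
    intro i j
    simp only [hκ_eq]
    have hre : Continuous fun zz : (Fin (deg i) → SpaceTime d) × (Fin (deg j) → SpaceTime d) =>
        ((fun k => zz.1 (Fin.rev k)), zz.2) :=
      ((continuous_pi fun k => (continuous_apply (Fin.rev k)).comp continuous_fst).prodMk
        continuous_snd)
    have happ := (continuous_fin_append (p := deg i) (q := deg j) (α := SpaceTime d)).comp hre
    exact (h𝔚c i j).comp happ
  -- the approximating integrals are the kernel pairings
  have hGc : ∀ i j, HasCompactSupport (G i j : (Fin (deg i + deg j) → SpaceTime d) → ℂ) := by
    intro i j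
    rw [eq_appendTensor_of_isAppendTensorOf (hG i j)]
    exact hasCompactSupport_appendTensor (hasCompactSupport_starTest_permTest_revPerm (hFc i)) (hFc j)
  have hIeq : ∀ i j, I i j t = ∫ x, ∫ x', κ ⟨i, x⟩ ⟨j, x'⟩ * (conj (F i x) * F j x') := by
    intro i j
    simp only [hI]
    have hint : Integrable fun ξ : Fin (deg i + deg j) → SpaceTime d =>
        𝔚 (deg i + deg j) (rayConfig (pairDir d (deg i) (deg j)) ξ t) * G i j ξ :=
      ((h𝔚c i j).mul (G i j).continuous).integrable_of_hasCompactSupport (hGc i j).mul_left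
    rw [integral_finAppend_eq_integral_integral (deg i) (deg j) hint,
      ← integral_comp_rev (E := SpaceTime d) (fun x => ∫ x' : Fin (deg j) → SpaceTime d,
        𝔚 (deg i + deg j) (rayConfig (pairDir d (deg i) (deg j)) (Fin.append x x') t) *
          G i j (Fin.append x x'))]
    congr 1; funext x; congr 1; funext x'
    rw [hκ_eq, hG i j, append_comp_castAdd, append_comp_natAdd, starTest_permTest_revPerm_apply]
    simp only [Fin.rev_rev]
  rw [Finset.sum_congr rfl fun i _ => Finset.sum_congr rfl fun j _ => hIeq i j]
  exact sum_integral_integral_kernel_nonneg deg κ hκPD hκc (fun i x => F i x)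
    (fun i => (F i).continuous) hFc

end Step3

/-! ### Step 4: product cutoffs and the discharge of `OS1973_positiveDefinite` -/

section Cutoff

variable {n p q : ℕ}

variable (d) in
/-- The one-block bump `χ` on `ℝ^{1+d}`: `= 1` on the unit ball, supported in the ball of radius `2`. [folklore] -/
def blockBump : ContDiffBump (0 : SpaceTime d) := ⟨1, 2, one_pos, one_lt_two⟩

variable (d n) in
/-- The **product cutoff** `W_R(x) = ∏ₖ χ(x_k / R)` on `n`-point configurations (real-valued). [folklore] -/
def prodCutoff (R : ℝ) (x : Fin n → SpaceTime d) : ℝ := ∏ k, blockBump d (R⁻¹ • x k)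

variable (d n) in
/-- The complexified product cutoff. [folklore] -/
def blockCutoff (R : ℝ) (x : Fin n → SpaceTime d) : ℂ := (prodCutoff d n R x : ℂ)

/-- The factors of the product cutoff as compositions with continuous linear maps of norm `≤ 1`
(`R ≥ 1`). [folklore] -/
theorem blockBump_smul_eq_comp (R : ℝ) (k : Fin n) :
    (fun x : Fin n → SpaceTime d => blockBump d (R⁻¹ • x k)) =
      (blockBump d : SpaceTime d → ℝ) ∘
        (R⁻¹ • ContinuousLinearMap.proj (R := ℝ) (φ := fun _ : Fin n => SpaceTime d) k) := by
  funext x; simp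

/-- Norm of the scaled coordinate projection. [folklore] -/
theorem norm_smul_proj_le {R : ℝ} (hR : 1 ≤ R) (k : Fin n) :
    ‖R⁻¹ • ContinuousLinearMap.proj (R := ℝ) (φ := fun _ : Fin n => SpaceTime d) k‖ ≤ 1 := by
  have hproj : ‖ContinuousLinearMap.proj (R := ℝ) (φ := fun _ : Fin n => SpaceTime d) k‖ ≤ 1 :=
    ContinuousLinearMap.opNorm_le_bound _ zero_le_one fun x => by
      simpa using norm_le_pi_norm x k
  rw [norm_smul, norm_inv, Real.norm_of_nonneg (by linarith)]
  calc R⁻¹ * ‖ContinuousLinearMap.proj (R := ℝ) (φ := fun _ : Fin n => SpaceTime d) k‖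
      ≤ 1 * 1 := mul_le_mul (inv_le_one_of_one_le₀ hR) hproj (norm_nonneg _) zero_le_one
    _ = 1 := one_mul _

/-- Precomposition with a continuous linear map of norm `≤ 1` (between possibly different spaces)
does not increase the norms of the iterated derivatives. [folklore] -/
theorem norm_iteratedFDeriv_comp_clm_le' {E₁ E₂ G : Type*} [NormedAddCommGroup E₁] [NormedSpace ℝ E₁]
    [NormedAddCommGroup E₂] [NormedSpace ℝ E₂] [NormedAddCommGroup G] [NormedSpace ℝ G]
    {g : E₂ → G} (hg : ContDiff ℝ ∞ g) (L : E₁ →L[ℝ] E₂) (hL : ‖L‖ ≤ 1) (i : ℕ) (x : E₁) :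
    ‖iteratedFDeriv ℝ i (g ∘ L) x‖ ≤ ‖iteratedFDeriv ℝ i g (L x)‖ := by
  rw [L.iteratedFDeriv_comp_right hg x (by exact_mod_cast le_top)]
  refine (ContinuousMultilinearMap.norm_compContinuousLinearMap_le _ _).trans ?_
  refine mul_le_of_le_one_right (norm_nonneg _) ?_
  exact Finset.prod_le_one (fun _ _ => norm_nonneg _) fun _ _ => hL

/-- The product cutoff is smooth. [folklore] -/
theorem contDiff_prodCutoff (R : ℝ) : ContDiff ℝ ∞ (prodCutoff d n R) := by
  unfold prodCutoff
  exact contDiff_prod fun k _ => (blockBump d).contDiff.comp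
    ((contDiff_apply ℝ (SpaceTime d) k).const_smul R⁻¹)

/-- **Uniform derivative bounds** for the product cutoffs, `R ≥ 1` (Leibniz + chain rule with a
contraction). [folklore] -/
theorem exists_bound_iteratedFDeriv_prodCutoff (n : ℕ) :
    ∃ A : ℕ → ℝ, ∀ R : ℝ, 1 ≤ R → ∀ j x, ‖iteratedFDeriv ℝ j (prodCutoff d n R) x‖ ≤ A j := by
  -- bounds for the one-block bump
  have hB : ∀ j, ∃ B : ℝ, ∀ v, ‖iteratedFDeriv ℝ j (blockBump d : SpaceTime d → ℝ) v‖ ≤ B := fun j =>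
    ((blockBump d).contDiff.continuous_iteratedFDeriv (mod_cast le_top)).bounded_above_of_compact_support
      ((blockBump d).hasCompactSupport.iteratedFDeriv j)
  choose B hB using hB
  obtain ⟨A, hA⟩ := exists_bound_iteratedFDeriv_prod (X := Fin n → SpaceTime d) (ι' := Fin n) B n
  refine ⟨A, fun R hR j x => ?_⟩
  have h := hA Finset.univ (by simp) (fun k x => blockBump d (R⁻¹ • x k))
    (fun k _ => (blockBump d).contDiff.comp ((contDiff_apply ℝ (SpaceTime d) k).const_smul R⁻¹))
    (fun k _ i y => by
      rw [blockBump_smul_eq_comp R k]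
      exact (norm_iteratedFDeriv_comp_clm_le' (blockBump d).contDiff _ (norm_smul_proj_le hR k) i y).trans
        (hB i _)) j x
  exact h

/-- Coercion `ℝ → ℂ` preserves the norms of all derivatives (Complex-coercion form of
`norm_iteratedFDeriv_ofReal_comp`). [folklore] -/
theorem norm_iteratedFDeriv_coe_complex_comp {X : Type*} [NormedAddCommGroup X] [NormedSpace ℝ X]
    {f : X → ℝ} (hf : ContDiff ℝ ∞ f) (j : ℕ) (x : X) :
    ‖iteratedFDeriv ℝ j (fun x => (f x : ℂ)) x‖ = ‖iteratedFDeriv ℝ j f x‖ := by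
  have h : (fun x => (f x : ℂ)) = Complex.ofRealLI ∘ f := by funext x; rfl
  rw [h]
  exact Complex.ofRealLI.norm_iteratedFDeriv_comp_left hf.contDiffAt (mod_cast le_top)

/-- The product cutoff has temperate growth (`R ≥ 1`). [folklore] -/
theorem hasTemperateGrowth_blockCutoff {R : ℝ} (hR : 1 ≤ R) : (blockCutoff d n R).HasTemperateGrowth := by
  obtain ⟨A, hA⟩ := exists_bound_iteratedFDeriv_prodCutoff (d := d) n
  refine hasTemperateGrowth_of_bounds (contDiff_ofReal_comp ℂ (contDiff_prodCutoff R)) A fun j x => ?_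
  rw [show (blockCutoff d n R) = fun x => ((prodCutoff d n R x : ℝ) : ℂ) from rfl,
    norm_iteratedFDeriv_coe_complex_comp (contDiff_prodCutoff R)]
  exact hA R hR j x

/-- The product cutoff equals `1` on the ball of radius `R` (`R > 0`). [folklore] -/
theorem blockCutoff_eq_one {R : ℝ} (hR : 0 < R) {x : Fin n → SpaceTime d} (hx : ‖x‖ ≤ R) :
    blockCutoff d n R x = 1 := by
  unfold blockCutoff prodCutoff
  rw [Finset.prod_eq_one fun k _ => ?_]
  · simp
  · refine (blockBump d).one_of_mem_closedBall ?_
    rw [mem_closedBall, dist_zero_right, norm_smul, norm_inv, Real.norm_of_nonneg hR.le]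
    show R⁻¹ * ‖x k‖ ≤ 1
    rw [inv_mul_le_iff₀ hR, mul_one]
    exact (norm_le_pi_norm x k).trans hx

/-- The product cutoff is invariant under reversing the arguments. [folklore] -/
theorem blockCutoff_comp_rev (R : ℝ) (x : Fin n → SpaceTime d) :
    blockCutoff d n R (fun k => x (Fin.rev k)) = blockCutoff d n R x := by
  unfold blockCutoff prodCutoff
  congr 1
  exact Fintype.prod_equiv Fin.revPerm _ _ fun k => rfl

/-- The product cutoff is multiplicative at an append point. [folklore] -/
theorem blockCutoff_add (R : ℝ) (z : Fin (p + q) → SpaceTime d) :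
    blockCutoff d (p + q) R z =
      blockCutoff d p R (z ∘ Fin.castAdd q) * blockCutoff d q R (z ∘ Fin.natAdd p) := by
  unfold blockCutoff prodCutoff
  rw [Fin.prod_univ_add]
  push_cast
  rfl

/-- The product cutoff is real. [folklore] -/
theorem conj_blockCutoff (R : ℝ) (x : Fin n → SpaceTime d) :
    conj (blockCutoff d n R x) = blockCutoff d n R x := by
  unfold blockCutoff; exact conj_ofReal _

/-- The product cutoff has compact support (`R > 0`). [folklore] -/
theorem hasCompactSupport_blockCutoff {R : ℝ} (hR : 0 < R) : HasCompactSupport (blockCutoff d n R) := by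
  refine HasCompactSupport.intro (isCompact_closedBall (0 : Fin n → SpaceTime d) (2 * R)) fun x hx => ?_
  rw [mem_closedBall, dist_zero_right, not_le] at hx
  -- some block coordinate is large
  obtain ⟨k, hk⟩ : ∃ k, 2 * R < ‖x k‖ := by
    by_contra h
    push Not at h
    exact (lt_irrefl _ (hx.trans_le ((pi_norm_le_iff_of_nonneg (by linarith)).2 h)))
  unfold blockCutoff prodCutoff
  rw [Finset.prod_eq_zero (Finset.mem_univ k), ofReal_zero]
  refine (blockBump d).zero_of_le_dist ?_
  rw [dist_zero_right, norm_smul, norm_inv, Real.norm_of_nonneg hR.le]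
  show (2 : ℝ) ≤ R⁻¹ * ‖x k‖
  rw [le_inv_mul_iff₀ hR]
  linarith

/-- **The product cutoffs converge to the identity on Schwartz space**: `W_{m+1} f → f`. [folklore] -/
theorem tendsto_smulLeftCLM_blockCutoff (f : 𝓢((Fin n → SpaceTime d), ℂ)) :
    Tendsto (fun m : ℕ => SchwartzMap.smulLeftCLM ℂ (blockCutoff d n ((m : ℝ) + 1)) f) atTop (𝓝 f) := by
  obtain ⟨A, hA⟩ := exists_bound_iteratedFDeriv_prodCutoff (d := d) n
  have h1 : ∀ m : ℕ, (1 : ℝ) ≤ (m : ℝ) + 1 := fun m => by linarith [m.cast_nonneg (α := ℝ)]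
  refine tendsto_smulLeftCLM_of_eq_one ℂ f (fun m : ℕ => blockCutoff d n ((m : ℝ) + 1))
    (fun m => contDiff_ofReal_comp ℂ (contDiff_prodCutoff _))
    (fun m => hasTemperateGrowth_blockCutoff (h1 m)) A (fun m j x => ?_) (fun m : ℕ => (m : ℝ) + 1)
    (tendsto_natCast_atTop_atTop.atTop_add tendsto_const_nhds) (fun m x hx =>
      blockCutoff_eq_one (by linarith [h1 m]) hx)
  rw [show (blockCutoff d n ((m : ℝ) + 1)) = fun x => ((prodCutoff d n ((m : ℝ) + 1) x : ℝ) : ℂ)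
    from rfl, norm_iteratedFDeriv_coe_complex_comp (contDiff_prodCutoff _)]
  exact hA _ (h1 m) j x

end Cutoff

/-- **Discharge of (A₃, R2): positivity of the OS boundary values** (Osterwalder–Schrader I
(1973), §4.3 "Positivity", (4.18)–(4.28): from reflection positivity E2 — here by V. Glaser's
route (Comm. Math. Phys. 37 (1974), §2): the Gram kernel `𝕂(z, w) = 𝔚ext(revConj z, w)` of the
continued Schwinger functions is positive-semidefinite at Euclidean points by E2
(`isPosSemidefKernelOn_osKernel_euclidPts`), hence on the tube by analytic continuation
(`isPosSemidefKernelOn_osKernel_mixedPts`, Glaser's lemma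
`Literature.Analysis.Complex.isPosSemidefKernelOn_halfPlane_of_ofReal`), hence the boundary
values are positive on compactly supported test functions
(`sum_boundaryValue_nonneg_of_hasCompactSupport`), hence on all test functions by product
cutoffs and continuity of `𝒲ₙ`). For every OS family `S` (with E0') and every OS continuation
family `𝒲` of `S`, `𝒲` has the Wightman property (e) `IsPositiveDefiniteFamily`. [cite: OsterwalderSchraderCMP1973, §4.3 (R2 from E2)] -/
theorem OS1973_positiveDefinite_holds : OS1973_positiveDefinite := by
  intro d _ S hOS _ 𝒲 h𝒲 N deg lab F G hG
  -- the cut-off test functions and witnesses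
  set W : (n : ℕ) → ℕ → (Fin n → SpaceTime d) → ℂ := fun n m => blockCutoff d n ((m : ℝ) + 1) with hW
  have h1 : ∀ m : ℕ, (1 : ℝ) ≤ (m : ℝ) + 1 := fun m => by linarith [m.cast_nonneg (α := ℝ)]
  have hWt : ∀ n m, (W n m).HasTemperateGrowth := fun n m => hasTemperateGrowth_blockCutoff (h1 m)
  set FR : ℕ → (i : Fin N) → 𝓢((Fin (deg i) → SpaceTime d), ℂ) :=
    fun m i => SchwartzMap.smulLeftCLM ℂ (W (deg i) m) (F i) with hFR
  set GR : ℕ → (i j : Fin N) → 𝓢((Fin (deg i + deg j) → SpaceTime d), ℂ) :=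
    fun m i j => SchwartzMap.smulLeftCLM ℂ (W (deg i + deg j) m) (G i j) with hGR_def
  have hGR : ∀ m i j,
      IsAppendTensorOf (GR m i j) (starTest (permTest Fin.revPerm (FR m i))) (FR m j) := by
    intro m i j z
    have e1 : GR m i j z = W (deg i + deg j) m z * G i j z := by
      simp only [hGR_def, SchwartzMap.smulLeftCLM_apply_apply (hWt _ _), smul_eq_mul]
    have e2 : ∀ y, FR m i y = W (deg i) m y * F i y := fun y => by
      simp only [hFR, SchwartzMap.smulLeftCLM_apply_apply (hWt _ _), smul_eq_mul]
    have e3 : ∀ y, FR m j y = W (deg j) m y * F j y := fun y => by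
      simp only [hFR, SchwartzMap.smulLeftCLM_apply_apply (hWt _ _), smul_eq_mul]
    rw [e1, starTest_permTest_revPerm_apply, e2, e3, hG i j z, starTest_permTest_revPerm_apply, map_mul,
      show W (deg i + deg j) m z = W (deg i) m (z ∘ Fin.castAdd (deg j)) *
        W (deg j) m (z ∘ Fin.natAdd (deg i)) from blockCutoff_add _ z,
      show W (deg i) m (fun k => (z ∘ Fin.castAdd (deg j)) (Fin.rev k)) =
        W (deg i) m (z ∘ Fin.castAdd (deg j)) from blockCutoff_comp_rev _ _,
      show conj (W (deg i) m (z ∘ Fin.castAdd (deg j))) = W (deg i) m (z ∘ Fin.castAdd (deg j)) from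
        conj_blockCutoff _ _]
    ring
  have hFRc : ∀ m i, HasCompactSupport (FR m i : (Fin (deg i) → SpaceTime d) → ℂ) := by
    intro m i
    rw [hFR, SchwartzMap.smulLeftCLM_apply (hWt _ _)]
    exact (hasCompactSupport_blockCutoff (by linarith [h1 m])).mul_right
  -- positivity of the cut-off sums (Step 3)
  have hpos : ∀ m, 0 ≤ ∑ i, ∑ j, 𝒲 (deg i + deg j) (Fin.append (lab i ∘ Fin.rev) (lab j)) (GR m i j) :=
    fun m => sum_boundaryValue_nonneg_of_hasCompactSupport hOS.covariant hOS.reflectionPositive h𝒲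
      deg (FR m) (hFRc m) (GR m) (hGR m) _
  -- removal of the cutoffs
  have hlim : Tendsto (fun m => ∑ i, ∑ j,
      𝒲 (deg i + deg j) (Fin.append (lab i ∘ Fin.rev) (lab j)) (GR m i j)) atTop
      (𝓝 (∑ i, ∑ j, 𝒲 (deg i + deg j) (Fin.append (lab i ∘ Fin.rev) (lab j)) (G i j))) :=
    tendsto_finsetSum _ fun i _ => tendsto_finsetSum _ fun j _ =>
      ((𝒲 (deg i + deg j) _).continuous.tendsto _).comp (tendsto_smulLeftCLM_blockCutoff (G i j))
  exact ge_of_tendsto' hlim hpos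

end Literature.MathematicalPhysics.QuantumFieldTheory
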